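import Literature.NumberTheory.Sieve.HeathBrownCubicTypeIIS4Bound
import HarnessLib

/-!
# Heath-Brown's Lemma 3.10 for a twisted weight `w(β̂) F_β` — the objects of §§11–13

D. R. Heath-Brown, *Primes represented by `x³ + 2y³`*, Acta Math. 186 (2001), Lemma 3.10 (§§11–13)
bounds the bilinear (Type II) sums via the dispersion sum `S = ∑_{α ∈ Q} |∑_β F_β W(αβ)|²`. The
residue-class version (D. R. Heath-Brown, B. Z. Moroz, *On the representation of primes by cubic
polynomials in two variables*, Proc. LMS 88 (2004), Prop. 4.2 (ii), (4.6)–(4.9)) needs the same bound with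
`F_β` replaced by a TWISTED weight `w(β̂) F_β`: after Cauchy's inequality the residue class of `αβ` modulo
`d` is carried by an indicator `w(β̂) = [β̂ ≡ v (mod d)]` on the `β`-variable (HBM04 p. 23: "we decompose
the sum according to the residue classes of `β₁, β₂` modulo `d`"). This file declares the §§11–13 objects
of the tree's d = 1 development (`HeathBrownCubicTypeIICauchy` … `HeathBrownCubicTypeIIClassISum`) for
the twisted weight, in the namespace `CubicSieve.Twisted` with the SAME names and one extra argument
`w : ℤ × ℤ × ℤ → ℝ` (placed after `T`, resp. after `m` for `Fprim`/`Ag`):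
`Fb`, `innerSum`, `Ssum`, `S1sum`, `S2sum` (§11 p. 68), `S3sum`, `S4sum` (§11 p. 70), `S4plus` (§12 p. 72),
`S5`, `S6` (Lemma 12.1), `classISum`, `PhiSum` (§12 p. 77), `Fprim`, `Ag` (§13 (13.6)).
The untwisted sets (`Abox`, `Bbox`, `Wab`, `nAB`, `Dhcf`, `aplus`, `PP`, `LC`, `TI`, `cellOf`, …) are the
tree's. The proofs (`S = S₁ + S₂`, …, the twisted `Ssum_le_of_params`) are in the files
`HeathBrownCubicTwisted{Cauchy,OffDiag,Localise,SmallQ,ClassISum,UstarBound,S4Bound,Ssum}`.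
Design choice: a general real twist `w` (the proofs use `|w| ≤ 1`, and in §13 `d`-periodicity), which
covers the residue indicators of HBM04 (4.6) and real parts of characters of `(ℤ/d)³` alike.

## References

* D. R. Heath-Brown, Acta Math. 186 (2001), §§11–13. [cite: HeathBrownActa2001, Lemma 3.10]
* D. R. Heath-Brown, B. Z. Moroz, Proc. London Math. Soc. 88 (2004), Prop. 4.2 (ii), (4.6)–(4.9).
  [cite: HeathBrownMoroz2004, Proposition 4.2]

## Mathlib / tree search

Tree: `HeathBrownCubicTypeIICauchy`, `…OffDiag`, `…Forms`, `…Localise`, `…SmallQ`, `…ClassISum` (the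
untwisted objects, same names in namespace `CubicSieve`). `lean search "Twisted"`: nothing in `CubicSieve`.
-/

noncomputable section

open Finset NumberField

namespace Literature.NumberTheory.Sieve.CubicSieve.Twisted

open LFunctions.CubeRootTwoField CubicPrimes CubicSieve LargeSieve

section Defs

variable (X η τ : ℝ) {k : ℕ} (m : Fin k → ℕ) (V T : ℝ) (w : ℤ × ℤ × ℤ → ℝ)

/-- **The twisted weight `w(β̂) F_β`** (HBM04 (4.6): `F_β` restricted to a residue class of `β̂`).
[cite: HeathBrownMoroz2004, Proposition 4.2] -/
def Fb (b : ℤ × ℤ × ℤ) : ℝ := w b * CubicSieve.Fb X τ m V T b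

/-- **`∑_β w(β̂) F_β W(αβ)`**, the twisted inner sum of Cauchy's inequality. [cite: HeathBrownActa2001, §11 p. 68] -/
def innerSum (a : ℤ × ℤ × ℤ) : ℝ := ∑ b ∈ Bbox T, if Wab X η a b then Fb X τ m V T w b else 0

open scoped Classical in
/-- **`S(w) = ∑_{α̂ primitive} |∑_β w(β̂) F_β W(αβ)|²`** (HBM04 (4.7) with the class on `β`).
[cite: HeathBrownActa2001, §11 p. 68] -/
def Ssum : ℝ := ∑ a ∈ (Abox X T).filter IsPrimitiveVec, innerSum X η τ m V T w a ^ 2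

open scoped Classical in
/-- **`S₁(w)`**, the diagonal terms `β₁ = β₂` of `S(w)`. [cite: HeathBrownActa2001, §11 p. 68] -/
def S1sum : ℝ :=
  ∑ a ∈ (Abox X T).filter IsPrimitiveVec, ∑ b ∈ Bbox T, if Wab X η a b then Fb X τ m V T w b ^ 2 else 0

open scoped Classical in
/-- **`S₂(w)`**, the off-diagonal terms `β₁ ≠ β₂` of `S(w)`. [cite: HeathBrownActa2001, §11 p. 68] -/
def S2sum : ℝ :=
  ∑ a ∈ (Abox X T).filter IsPrimitiveVec, ∑ bb ∈ (Bbox T).offDiag,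
    if Wab X η a bb.1 ∧ Wab X η a bb.2 then Fb X τ m V T w bb.1 * Fb X τ m V T w bb.2 else 0

open scoped Classical in
/-- **`S₃(w)`**: the part of `S₂(w)` with `D ≤ Δ₀`. [cite: HeathBrownActa2001, §11 p. 70] -/
def S3sum (Δ₀ : ℝ) : ℝ :=
  ∑ bb ∈ ((Bbox T).offDiag).filter (fun bb => (Dhcf bb : ℝ) ≤ Δ₀),
    Fb X τ m V T w bb.1 * Fb X τ m V T w bb.2 * nAB X η T bb

open scoped Classical in
/-- **`S₄(w)`**: the part of `S₂(w)` with `D > Δ₀`. [cite: HeathBrownActa2001, Lemma 11.2] -/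
def S4sum (Δ₀ : ℝ) : ℝ :=
  ∑ bb ∈ ((Bbox T).offDiag).filter (fun bb => Δ₀ < (Dhcf bb : ℝ)),
    Fb X τ m V T w bb.1 * Fb X τ m V T w bb.2 * nAB X η T bb

open scoped Classical in
/-- **`S₄⁺(w)`**: `∑_{β₁ ≠ β₂, D > Δ₀} w(β̂₁)F_{β₁} w(β̂₂)F_{β₂} W(D⁻¹p₁)W(D⁻¹p₂)`.
[cite: HeathBrownActa2001, §12 p. 72] -/
def S4plus (Δ₀ : ℝ) : ℝ :=
  ∑ bb ∈ ((Bbox T).offDiag).filter (fun bb => Δ₀ < (Dhcf bb : ℝ)),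
    if Wab X η (aplus bb) bb.1 ∧ Wab X η (aplus bb) bb.2 then Fb X τ m V T w bb.1 * Fb X τ m V T w bb.2 else 0

open scoped Classical in
/-- **`F'_β(w) = w(β̂) f_(β) · [β̂ primitive]`** (§13 p. 82, twisted). [cite: HeathBrownActa2001, §13 p. 82] -/
def Fprim (v : ℤ × ℤ × ℤ) : ℝ := w v * CubicSieve.Fprim X τ m v

open scoped Classical in
/-- The twisted inner sums `A_g(w) = ∑_{β̂ ∈ C, g ∣ β̂} w(β̂) f_(β) e(b·β̂/q)` of (13.6).
[cite: HeathBrownActa2001, §13 (13.6)] -/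
def Ag (C : Finset (ℤ × ℤ × ℤ)) (q : ℕ) (b : ℤ × ℤ × ℤ) (g : ℕ) : ℂ :=
  ∑ v ∈ C.filter (fun v => DvdVec (g : ℤ) v),
    ((w v * fWeight X τ m (Ideal.span {coordElt v}) : ℝ) : ℂ) * LargeSieve.e ((dot3 b v : ℤ) / (q : ℝ))

variable (N : ℕ) (Δ₀ : ℝ)

open scoped Classical in
/-- **`S₅(w; t, 𝐧, 𝐧')`**: the part of `S₄⁺(w)` from the pairs of the tree's `PP` in the cell (the
untwisted support set `PP` is the right index set since `wF ≠ 0 ⇒ F ≠ 0`). [cite: HeathBrownActa2001, Lemma 12.1] -/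
def S5 (c : ℕ × ((ℤ × ℤ × ℤ) × (ℤ × ℤ × ℤ))) : ℝ :=
  ∑ bb ∈ (PP X η τ m V T Δ₀).filter (fun bb => cellOf N (T / N) bb = c), Fb X τ m V T w bb.1 * Fb X τ m V T w bb.2

open scoped Classical in
/-- **`S₆(w; t, 𝐧, 𝐧')`**: `∑_{β̂_i ∈ C_i primitive, D > Δ₀, cell(D) = t} w(β̂₁)f_{(β₁)} w(β̂₂)f_{(β₂)}`.
[cite: HeathBrownActa2001, Lemma 12.1] -/
def S6 (t : ℕ) (n n' : ℤ × ℤ × ℤ) : ℝ :=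
  ∑ bb ∈ (LC (T / N) n ×ˢ LC (T / N) n').filter (fun bb => IsPrimitiveVec bb.1 ∧ IsPrimitiveVec bb.2 ∧
      Δ₀ < (Dhcf bb : ℝ) ∧ tIdx N (Dhcf bb) = t),
    (w bb.1 * fWeight X τ m (Ideal.span {coordElt bb.1})) * (w bb.2 * fWeight X τ m (Ideal.span {coordElt bb.2}))

open scoped Classical in
/-- **`∑_{t : Class I} S₆(w; t, 𝐧, 𝐧')`**. [cite: HeathBrownActa2001, Lemma 12.1] -/
def classISum (n n' : ℤ × ℤ × ℤ) : ℝ :=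
  ∑ t ∈ TI X η V T N Δ₀ n n', S6 X τ m T w N Δ₀ t n n'

open scoped Classical in
/-- The twisted divisibility sums `Φ_w(e) = ∑_{β̂ᵢ ∈ Cᵢ, e ∣ β̂₁∧β̂₂} F'_{β₁}(w)F'_{β₂}(w)`.
[cite: HeathBrownActa2001, §12 p. 77] -/
def PhiSum (n n' : ℤ × ℤ × ℤ) (e : ℕ) : ℝ :=
  ∑ b₁ ∈ LC (T / N) n, ∑ b₂ ∈ LC (T / N) n',
    (if DvdVec (e : ℤ) (cross3 b₁ b₂) then Fprim X τ m w b₁ * Fprim X τ m w b₂ else 0)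

end Defs

variable {X η τ V T : ℝ} {k : ℕ} {m : Fin k → ℕ} {w : ℤ × ℤ × ℤ → ℝ}

/-- The twisted weight unfolded. [cite: HeathBrownMoroz2004, Proposition 4.2] -/
theorem Fb_def (b : ℤ × ℤ × ℤ) : Fb X τ m V T w b = w b * CubicSieve.Fb X τ m V T b := rfl

/-- The twisted `F'` unfolded. [cite: HeathBrownActa2001, §13 p. 82] -/
theorem Fprim_def (v : ℤ × ℤ × ℤ) : Fprim X τ m w v = w v * CubicSieve.Fprim X τ m v := rfl

/-- With the trivial twist `w ≡ 1` the twisted weight is Heath-Brown's `F_β`. [cite: HeathBrownActa2001, §11 p. 68] -/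
theorem Fb_one (b : ℤ × ℤ × ℤ) : Fb X τ m V T (fun _ => 1) b = CubicSieve.Fb X τ m V T b := by
  rw [Fb_def, one_mul]

/-- With the trivial twist `w ≡ 1`, `S(1)` is Heath-Brown's `S` (consistency with the d = 1 theory).
[cite: HeathBrownActa2001, §11 p. 68] -/
theorem Ssum_one : Ssum X η τ m V T (fun _ => 1) = CubicSieve.Ssum X η τ m V T := by
  classical
  simp only [Ssum, CubicSieve.Ssum, innerSum, CubicSieve.innerSum, Fb_one]

end Literature.NumberTheory.Sieve.CubicSieve.Twisted

end
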